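import Mathlib

/-!
# `DeformedRung` (stmt-HubbardSuperconductivity-1894, route `DeformationLadder`) — the Danskin step

Pure real analysis of the variational formula `e_U(g) = inf_{h ≥ 0} [ẽ_U(h) + h²/g]` for the
ground-state energy density of the deformed model `K_L(U,g) = H_L - (g/L²) pFᴴ pF`
(approximating-Hamiltonian / Bogoliubov-Jr. form; `ẽ_U` = the `d`-wave source energy density at
repulsion `U`). If

* (sandwich) `e₀ ≤ ẽ_U ≤ e₀ + U` on `h ≥ 0` (positivity of the on-site repulsion, item
  `EnergySandwich`),
* (continuity at `h = 0`) `e₀(h) ≥ e₀(0) - ε/4` for `0 ≤ h ≤ r₀`,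
* (Cooper gap) `e₀(h₁) + h₁²/g + ε ≤ e₀(0)` for some `h₁ ≥ 0` (item `FreeCooperLogarithm`),
* `U ≤ ε/2`,

then the infimum defining `e_U(g)` is not approached on `[0, r₀]`, and consequently the energy
density strictly increases to the left of `g` with an explicit margin:
`e_U(g') ≥ e_U(g) + min(ε/4, r₀²(1/g' - 1/g))` for every `0 < g' < g` (`danskin_left_gap`), in
particular `e_U(g') > e_U(g)` (`danskin_left_lt`). This is the one-sided Danskin/envelope
inequality `-e_U′(g-) ≥ min_{argmin} h²/g² > 0` in the finite-difference form consumed by the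
Griffiths step (`Theorems/DeformationLadderDeformedRungGriffiths.lean`): no differentiability,
convexity or compactness is needed, only the pointwise bounds above. The infimum is Mathlib's
real `⨅` over `{h : ℝ // 0 ≤ h}` exactly as in item `ApproximatingHamiltonianGC`; boundedness below
of `h ↦ ẽ_U(h) + h²/g` is assumed (`danskin_bddBelow_of_linear` derives it from a linear lower
bound `ẽ_U(h) ≥ A - B h`, which is what `‖pF + pFᴴ‖ ≤ 8√2 L²` gives).

Sources: J. M. Danskin, *The Theory of Max-Min* (1967), Ch. I (one-sided derivatives of marginal
functions); R. B. Griffiths, J. Math. Phys. 5 (1964) 1215; N. N. Bogoliubov Jr., Physica 32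
(1966) 933 (the variational formula). All folklore real analysis; no definition is introduced.
-/

-- the mandated namespace `Summit.<Summit>.<Problem>.Theorems` repeats `HubbardSuperconductivity`
-- (single-problem summit, D-0017), which the `dupNamespace` linter flags on every declaration
set_option linter.dupNamespace false

noncomputable section

namespace Summit.HubbardSuperconductivity.HubbardSuperconductivity.Theorems.DeformationLadder

/-- **Boundedness below of the variational functional from a linear lower bound.** If
`ẽ(h) ≥ A - B h` for `h ≥ 0` then `h ↦ ẽ(h) + h²/g` (`g > 0`) is bounded below on `h ≥ 0` (by
`A - B² g/4`, completing the square). [folklore] -/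
theorem danskin_bddBelow_of_linear {eU : ℝ → ℝ} {A B g : ℝ} (hg : 0 < g)
    (hlin : ∀ h, 0 ≤ h → A - B * h ≤ eU h) :
    BddBelow (Set.range fun h : {h : ℝ // 0 ≤ h} => eU h + (h : ℝ) ^ 2 / g) := by
  refine ⟨A - B ^ 2 * g / 4, ?_⟩
  rintro _ ⟨⟨h, hh⟩, rfl⟩
  have h1 := hlin h hh
  have h2 : B * h ≤ (h : ℝ) ^ 2 / g + B ^ 2 * g / 4 := by
    rw [← sub_nonneg]
    have : (h : ℝ) ^ 2 / g + B ^ 2 * g / 4 - B * h = (h - B * g / 2) ^ 2 / g := by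
      field_simp
      ring
    rw [this]
    positivity
  dsimp only
  linarith

/-- **The variational value is below every trial value.** `⨅_{h ≥ 0} [ẽ(h) + h²/g] ≤ ẽ(h₁) + h₁²/g`
for `h₁ ≥ 0` (boundedness below assumed). [folklore] -/
theorem danskin_iInf_le {eU : ℝ → ℝ} {g h₁ : ℝ} (hh₁ : 0 ≤ h₁)
    (hbdd : BddBelow (Set.range fun h : {h : ℝ // 0 ≤ h} => eU h + (h : ℝ) ^ 2 / g)) :
    (⨅ h : {h : ℝ // 0 ≤ h}, eU h + (h : ℝ) ^ 2 / g) ≤ eU h₁ + h₁ ^ 2 / g :=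
  ciInf_le hbdd ⟨h₁, hh₁⟩

/-- **Danskin's one-sided inequality with a margin** (the left chord of
`g ↦ e_U(g) = inf_{h ≥ 0}[ẽ_U(h) + h²/g]` is strictly positive once the infimum avoids a
neighbourhood of `h = 0`). Under the sandwich `e₀ ≤ ẽ_U ≤ e₀ + U`, continuity of `e₀` at `0`
(`e₀ ≥ e₀(0) - ε/4` on `[0, r₀]`), the Cooper gap `e₀(h₁) + h₁²/g + ε ≤ e₀(0)` and `U ≤ ε/2`:
`e_U(g) + min(ε/4, r₀²(1/g' - 1/g)) ≤ e_U(g')` for all `0 < g' < g`. Proof: `e_U(g) ≤ e₀(0) - ε/2`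
(trial value at `h₁`); for `h ≤ r₀`, `ẽ_U(h) + h²/g' ≥ e₀(h) ≥ e₀(0) - ε/4 ≥ e_U(g) + ε/4`; for
`h ≥ r₀`, `ẽ_U(h) + h²/g' = [ẽ_U(h) + h²/g] + h²(1/g' - 1/g) ≥ e_U(g) + r₀²(1/g' - 1/g)`.
Danskin (1967) Ch. I; Griffiths, J. Math. Phys. 5 (1964) 1215. [folklore] -/
theorem danskin_left_gap {e₀ eU : ℝ → ℝ} {U g ε r₀ h₁ : ℝ} (hUε : U ≤ ε / 2)
    (hsand : ∀ h, 0 ≤ h → e₀ h ≤ eU h ∧ eU h ≤ e₀ h + U)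
    (hr₀ : 0 < r₀) (hcont : ∀ h, 0 ≤ h → h ≤ r₀ → e₀ 0 - ε / 4 ≤ e₀ h)
    (hh₁ : 0 ≤ h₁) (hgap : e₀ h₁ + h₁ ^ 2 / g + ε ≤ e₀ 0)
    (hbdd : BddBelow (Set.range fun h : {h : ℝ // 0 ≤ h} => eU h + (h : ℝ) ^ 2 / g))
    {g' : ℝ} (hg' : 0 < g') (hg'g : g' < g) :
    (⨅ h : {h : ℝ // 0 ≤ h}, eU h + (h : ℝ) ^ 2 / g) + min (ε / 4) (r₀ ^ 2 * (1 / g' - 1 / g)) ≤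
      ⨅ h : {h : ℝ // 0 ≤ h}, eU h + (h : ℝ) ^ 2 / g' := by
  set e := ⨅ h : {h : ℝ // 0 ≤ h}, eU h + (h : ℝ) ^ 2 / g with he_def
  -- the variational value at `g` sits `ε/2` below `e₀(0)`
  have he : e ≤ e₀ 0 - ε / 2 := by
    have h1 : e ≤ eU h₁ + h₁ ^ 2 / g := danskin_iInf_le hh₁ hbdd
    have h2 := (hsand h₁ hh₁).2
    linarith
  have hinv : 0 ≤ 1 / g' - 1 / g := by
    rw [sub_nonneg]
    exact one_div_le_one_div_of_le hg' hg'g.le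
  haveI : Nonempty {h : ℝ // 0 ≤ h} := ⟨⟨0, le_rfl⟩⟩
  refine le_ciInf fun x => ?_
  obtain ⟨h, hh⟩ := x
  dsimp only
  by_cases hhr : h ≤ r₀
  · -- near `h = 0` the functional stays `ε/4` above `e`
    have h1 := hcont h hh hhr
    have h2 := (hsand h hh).1
    have h3 : 0 ≤ h ^ 2 / g' := by positivity
    have h4 : min (ε / 4) (r₀ ^ 2 * (1 / g' - 1 / g)) ≤ ε / 4 := min_le_left _ _
    linarith
  · -- away from `0` the extra `h²(1/g' - 1/g) ≥ r₀²(1/g' - 1/g)` is gained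
    push Not at hhr
    have h1 : e ≤ eU h + h ^ 2 / g := danskin_iInf_le hh hbdd
    have h2 : r₀ ^ 2 * (1 / g' - 1 / g) ≤ h ^ 2 * (1 / g' - 1 / g) :=
      mul_le_mul_of_nonneg_right (pow_le_pow_left₀ hr₀.le hhr.le 2) hinv
    have h3 : min (ε / 4) (r₀ ^ 2 * (1 / g' - 1 / g)) ≤ r₀ ^ 2 * (1 / g' - 1 / g) := min_le_right _ _
    have h4 : eU h + h ^ 2 / g + h ^ 2 * (1 / g' - 1 / g) = eU h + h ^ 2 / g' := by ring
    linarith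

/-- **Strict left monotonicity** (corollary, `ε > 0`): under the hypotheses of `danskin_left_gap`,
`e_U(g) < e_U(g')` for every `0 < g' < g`. [folklore] -/
theorem danskin_left_lt {e₀ eU : ℝ → ℝ} {U g ε r₀ h₁ : ℝ} (hε : 0 < ε) (hUε : U ≤ ε / 2)
    (hsand : ∀ h, 0 ≤ h → e₀ h ≤ eU h ∧ eU h ≤ e₀ h + U)
    (hr₀ : 0 < r₀) (hcont : ∀ h, 0 ≤ h → h ≤ r₀ → e₀ 0 - ε / 4 ≤ e₀ h)
    (hh₁ : 0 ≤ h₁) (hgap : e₀ h₁ + h₁ ^ 2 / g + ε ≤ e₀ 0)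
    (hbdd : BddBelow (Set.range fun h : {h : ℝ // 0 ≤ h} => eU h + (h : ℝ) ^ 2 / g))
    {g' : ℝ} (hg' : 0 < g') (hg'g : g' < g) :
    (⨅ h : {h : ℝ // 0 ≤ h}, eU h + (h : ℝ) ^ 2 / g) <
      ⨅ h : {h : ℝ // 0 ≤ h}, eU h + (h : ℝ) ^ 2 / g' := by
  have key := danskin_left_gap hUε hsand hr₀ hcont hh₁ hgap hbdd hg' hg'g
  have hpos : 0 < min (ε / 4) (r₀ ^ 2 * (1 / g' - 1 / g)) := by
    refine lt_min (by linarith) (mul_pos (pow_pos hr₀ 2) ?_)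
    rw [sub_pos]
    exact one_div_lt_one_div_of_lt hg' hg'g
  linarith

/-- **A modulus of continuity at `h = 0` gives the `ε/4`-window.** If `e₀(h) ≥ e₀(0) - Λ h` for
`h ≥ 0` (`Λ > 0`, e.g. `Λ = 8√2 ≥ L⁻²‖pF + pFᴴ‖`) then `e₀ ≥ e₀(0) - ε/4` on `[0, ε/(4Λ)]`.
[folklore] -/
theorem danskin_window_of_lipschitz {e₀ : ℝ → ℝ} {Λ ε : ℝ} (hΛ : 0 < Λ)
    (hlip : ∀ h, 0 ≤ h → e₀ 0 - Λ * h ≤ e₀ h) :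
    ∀ h, 0 ≤ h → h ≤ ε / (4 * Λ) → e₀ 0 - ε / 4 ≤ e₀ h := by
  intro h hh hhr
  have h1 := hlip h hh
  have h2 : Λ * h ≤ ε / 4 := by
    calc Λ * h ≤ Λ * (ε / (4 * Λ)) := mul_le_mul_of_nonneg_left hhr hΛ.le
      _ = ε / 4 := by field_simp
  linarith

end Summit.HubbardSuperconductivity.HubbardSuperconductivity.Theorems.DeformationLadder
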